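import Mathlib
import Literature.Geometry.DiscreteGeometry.KissingFanTriangleSets
import Summits.AtomisticToContinuum.Crystallization.Theorems.GappedShellCensusShellTrichotomyStubTCornerMax
import Summits.AtomisticToContinuum.Crystallization.Theorems.GappedShellCensusShellTrichotomyStubTCornerMin
import Summits.AtomisticToContinuum.Crystallization.Theorems.GappedShellCensusShellTrichotomyStubHCornerMax
import Summits.AtomisticToContinuum.Crystallization.Theorems.GappedShellCensusFiveFoldRationingRStubFfrC5DictAux1

/-!
# Crux `GappedShellCensus.FiveFoldRationingR` (stmt-AtomisticToContinuum-18071), line `Sketch` —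
# stub `stub_ffrC5Dict`: the dictionary of the capped torn-free single-shell census

**Geometry → labelled fan data, shell-degrees `≥ 4`.**  For a gapped twelve-shell
`t : Fin 12 → ℝ³` (norms in `[0.98, 1.02]`, pairwise distances `≥ 0.98` and either `≤ 1.02` — a
bond — or `≥ 1.26`) in which every point has AT LEAST four bonded shell neighbours, let
`u k = t k / ‖t k‖`, `X = {u k}` (the radially normalised shell), let `tri` be the set of label
sets `S ⊆ Fin 12` with `u '' S ∈ fanTriSets X` (the fan-refined hull triangulation of `X` pulled
back along the labelling) and `ang S k = triAngleAt X (u '' S) (u k)`.  Then: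

* (structure) every triple of `tri` has three labels; `tri` has twenty triples; every side of a
  triple lies in exactly two triples; every bond is a side of exactly two triples; every bonded
  triangle is a triple; the link of every label is connected (closure form);
* (angles) `ang ≥ 0`, `ang S k = 0` off `S`, the node equation `Σ_{S ∈ tri} ang S k = 2π`;
  the coupled corner bounds `T ≤ arccos (1/4)`, `T ≥ arccos (81/200)` (bonded triangles),
  `H ≤ arccos (807/2000)` (`{v, a, x}` with `va`, `ax` bonds, `vx` far),
  `Q ≤ 2 arccos (807/2000)` (`{v, d, a}` with the quad `v d x a` split by the far diagonal `vx`),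
  `Q ≥ arccos (1/25)` (`{v, d, a}` with `vd`, `va` bonds and `da` far) and the H-pair bound
  `ang {v,a,x} v + ang {v,x,z} v ≥ arccos (1/25)` (`va`, `vz` bonds, `az` far).

These are verbatim the conclusions of the sibling crux's `stub_fanStruct ∧ stub_fanAngles`
(ShellTrichotomy, all degrees EXACTLY four) plus the three lower bounds; the sibling's proofs go
through unchanged once their only degree-four input, `stub_originInterior`, is replaced by
`stub_ffrC5Interior` (degrees `≥ 4` ⇒ `0 ∈ interior (conv X)`, landed Aux1 of `stub_ffrCensus5`).
`stub_ffrC5Dict` is the `let` form of the skeleton (v12) of line `Sketch`; `stub_ffrC5DictArgs` is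
the same statement with `u`, `X`, `tri`, `ang` as explicit arguments (the registered sub-goal the
gate can match, as for the sibling's `stub_fanStruct` / `stub_fanStruct_let`).

## Proof

* Structure: transport along the bijection `S ↦ u '' S` (the labelling is injective,
  `ffrC5_normalize_injective`) of the tree's `card_eq_three_of_mem_fanTriSets`,
  `card_fanTriSets`, `card_filter_fanTriSets_eq_two`,
  `card_filter_fanTriSets_eq_two_of_mem_hullEdges` + `stub_bondHullEdge`,
  `stub_bondTriangleFacet`, `fanTriSets_link` — the `ffrC5D_*` transport lemmas of
  `…StubFfrC5DictAux1`.
* Angles: `triAngleAt_nonneg`, `triAngleAt_eq_zero_of_not_mem`, `sum_triAngleAt`; the angle of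
  a labelled fan triangle `{v, a, b}` at `v` is the dihedral angle
  `∠(perpTo (t v) (t a), perpTo (t v) (t b))` of the ORIGINAL points (`triAngleAt_eq_angle` and
  scale invariance `ffrC5D_angle_perpTo_smul`), to which the landed three-point corner stubs
  apply: `stub_tCornerMax`, `stub_tCornerMin`, `stub_hCornerMax` (twice, with the triangle
  inequality for angles, for the split quad), `stub_ffrC5QCornerMin` (Aux1), and
  `stub_ffrC5QCornerMin` with `InnerProductGeometry.angle_le_angle_add_angle` for the H-pair.
-/

noncomputable section

namespace Summit.AtomisticToContinuum.Crystallization.Theorems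

open scoped RealInnerProductSpace
open Literature.Geometry.DiscreteGeometry InnerProductGeometry

/-! ### Three-element label sets -/

/-- A three-element set `{v, a, b}` has `v ≠ a` and `v ≠ b`. [folklore] -/
theorem ffrC5D_ne_of_card_triple {α : Type*} [DecidableEq α] {v a b : α}
    (h : ({v, a, b} : Finset α).card = 3) : v ≠ a ∧ v ≠ b := by
  -- adapted from `ne_of_card_triple` of the sibling crux's
  -- `GappedShellCensusShellTrichotomyStubFanAngles.lean` (private there); likewise the next
  -- four lemmas
  constructor
  · rintro rfl
    rw [Finset.insert_idem] at h
    have := Finset.card_le_two (a := v) (b := b)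
    omega
  · rintro rfl
    rw [Finset.insert_eq_of_mem (Finset.mem_insert_of_mem (Finset.mem_singleton_self v))] at h
    have := Finset.card_le_two (a := a) (b := v)
    omega

/-- A three-element set containing `v` is `{v, a, b}` with `v, a, b` distinct. [folklore] -/
theorem ffrC5D_exists_eq_triple {α : Type*} [DecidableEq α] {S : Finset α} (hS : S.card = 3)
    {v : α} (hv : v ∈ S) : ∃ a b, v ≠ a ∧ v ≠ b ∧ a ≠ b ∧ S = {v, a, b} := by
  obtain ⟨x, y, z, hxy, hxz, hyz, rfl⟩ := Finset.card_eq_three.1 hS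
  simp only [Finset.mem_insert, Finset.mem_singleton] at hv
  rcases hv with rfl | rfl | rfl
  · exact ⟨y, z, hxy, hxz, hyz, rfl⟩
  · exact ⟨x, z, hxy.symm, hyz, hxz, Finset.insert_comm _ _ _⟩
  · exact ⟨x, y, hxz.symm, hyz.symm, hxy, by rw [Finset.pair_comm y, Finset.insert_comm]⟩

/-! ### The labelled fan: triangles and angles pulled back along `u` -/

/-- The fan triangles of `X = u '' univ` are exactly the images of the label triples whose image
is a fan triangle. [folklore] -/
theorem ffrC5D_fanTriSets_eq_image {u : Fin 12 → EuclideanSpace ℝ (Fin 3)}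
    (hX1 : ∀ y ∈ Finset.univ.image u, ‖y‖ = 1) :
    fanTriSets (Finset.univ.image u) =
      (Finset.univ.powerset.filter fun S : Finset (Fin 12) =>
        S.image u ∈ fanTriSets (Finset.univ.image u)).image fun S => S.image u := by
  ext T
  simp only [Finset.mem_image, Finset.mem_filter, Finset.mem_powerset, Finset.subset_univ,
    true_and]
  constructor
  · intro hT
    have himg : (Finset.univ.filter fun k => u k ∈ T).image u = T := by
      ext y
      simp only [Finset.mem_image, Finset.mem_filter, Finset.mem_univ, true_and]
      constructor
      · rintro ⟨k, hk, rfl⟩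
        exact hk
      · intro hy
        obtain ⟨k, -, rfl⟩ := Finset.mem_image.1 (subset_of_mem_fanTriSets hX1 hT hy)
        exact ⟨k, hy, rfl⟩
    exact ⟨_, by rw [himg]; exact hT, himg⟩
  · rintro ⟨S, hS, rfl⟩
    exact hS

/-- **Node equation on the labelled fan**: the angles at the label `v` of the label triples sum
to `2π`. [folklore] -/
theorem ffrC5D_sum_triAngleAt_labels {u : Fin 12 → EuclideanSpace ℝ (Fin 3)}
    (hX1 : ∀ y ∈ Finset.univ.image u, ‖y‖ = 1) (huinj : Function.Injective u)
    (h0 : (0 : EuclideanSpace ℝ (Fin 3)) ∈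
      interior (convexHull ℝ ((Finset.univ.image u : Finset (EuclideanSpace ℝ (Fin 3))) :
        Set (EuclideanSpace ℝ (Fin 3)))))
    (v : Fin 12) :
    ∑ S ∈ Finset.univ.powerset.filter (fun S : Finset (Fin 12) =>
        S.image u ∈ fanTriSets (Finset.univ.image u)),
      triAngleAt (Finset.univ.image u) (S.image u) (u v) = 2 * Real.pi := by
  have hinj : Set.InjOn (fun S : Finset (Fin 12) => S.image u)
      ↑(Finset.univ.powerset.filter fun S : Finset (Fin 12) =>
        S.image u ∈ fanTriSets (Finset.univ.image u)) :=
    (Finset.image_injective huinj).injOn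
  have h := sum_triAngleAt hX1 h0 (Finset.mem_image_of_mem u (Finset.mem_univ v))
  rwa [ffrC5D_fanTriSets_eq_image hX1, Finset.sum_image hinj] at h

/-- **The angle of a labelled fan triangle `{v, a, b}` at `v` is the dihedral angle of the
ORIGINAL points** `∠(perpTo (t v) (t a), perpTo (t v) (t b))`. [folklore] -/
theorem ffrC5D_triAngleAt_labels_eq {t u : Fin 12 → EuclideanSpace ℝ (Fin 3)}
    (hu : ∀ k, u k = ‖t k‖⁻¹ • t k) (hr : ∀ k, 0 < ‖t k‖)
    (hX1 : ∀ y ∈ Finset.univ.image u, ‖y‖ = 1)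
    (huinj : Function.Injective u) {v a b : Fin 12}
    (hT : ({v, a, b} : Finset (Fin 12)).image u ∈ fanTriSets (Finset.univ.image u))
    (hva : v ≠ a) (hvb : v ≠ b) :
    triAngleAt (Finset.univ.image u) (({v, a, b} : Finset (Fin 12)).image u) (u v) =
      angle (perpTo (t v) (t a)) (perpTo (t v) (t b)) := by
  have himg : ({v, a, b} : Finset (Fin 12)).image u = {u v, u a, u b} := by
    rw [Finset.image_insert, Finset.image_insert, Finset.image_singleton]
  rw [himg] at hT ⊢
  rw [triAngleAt_eq_angle hX1 hT (huinj.ne hva) (huinj.ne hvb), hu v, hu a, hu b]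
  exact ffrC5D_angle_perpTo_smul (t v) (t a) (t b) (inv_pos.2 (hr v)).ne' (inv_pos.2 (hr a))
    (inv_pos.2 (hr b))

/-! ### The stub -/

/-- **Dictionary of the capped torn-free census (geometry → labelled fan data, degrees `≥ 4`).**
For a gapped twelve-tuple with all shell-degrees `≥ 4`, the fan triangles of the hull of its
radial projection pulled back to label triples `tri`, and the corner angles `ang`: the sibling's
`stub_fanStruct` and `stub_fanAngles` conclusions (verbatim shapes; `0 ∈ interior (conv X)` now
from `stub_ffrC5Interior`) plus the lower corner bounds `T ≥ arccos (81/200)` (`stub_tCornerMin`),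
`Q ≥ arccos (1/25)` (`stub_ffrC5QCornerMin`) and the H-pair bound (triangle inequality for
angles + `stub_ffrC5QCornerMin`).  See the module docstring. [folklore] -/
theorem stub_ffrC5Dict (t : Fin 12 → EuclideanSpace ℝ (Fin 3)) (hinj : Function.Injective t)
    (hn : ∀ k, 1 - 1 / 50 ≤ ‖t k‖ ∧ ‖t k‖ ≤ 1 + 1 / 50)
    (hd : ∀ k l, k ≠ l → 1 - 1 / 50 ≤ dist (t k) (t l) ∧ (dist (t k) (t l) ≤ 1 + 1 / 50 ∨ 63 / 50 ≤ dist (t k) (t l)))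
    (h4 : ∀ k, 4 ≤ (Finset.univ.filter fun l => l ≠ k ∧ dist (t k) (t l) ≤ 1 + 1 / 50).card) :
    let u : Fin 12 → EuclideanSpace ℝ (Fin 3) := fun k => ‖t k‖⁻¹ • t k
    let X : Finset (EuclideanSpace ℝ (Fin 3)) := Finset.univ.image u
    let tri : Finset (Finset (Fin 12)) := Finset.univ.powerset.filter fun S => S.image u ∈ fanTriSets X
    let ang : Finset (Fin 12) → Fin 12 → ℝ := fun S k => triAngleAt X (S.image u) (u k)
    ((∀ S ∈ tri, S.card = 3) ∧ tri.card = 20 ∧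
      (∀ S ∈ tri, ∀ s ⊆ S, s.card = 2 → (tri.filter fun S' => s ⊆ S').card = 2) ∧
      (∀ v w, v ≠ w → dist (t v) (t w) ≤ 1 + 1 / 50 →
        (tri.filter fun S' => ({v, w} : Finset (Fin 12)) ⊆ S').card = 2) ∧
      (∀ a b c, a ≠ b → b ≠ c → a ≠ c → dist (t a) (t b) ≤ 1 + 1 / 50 → dist (t b) (t c) ≤ 1 + 1 / 50 →
        dist (t a) (t c) ≤ 1 + 1 / 50 → ({a, b, c} : Finset (Fin 12)) ∈ tri) ∧
      (∀ v, ∀ A ⊆ tri.filter (fun S => v ∈ S), A.Nonempty →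
        (∀ S ∈ A, ∀ S' ∈ tri, v ∈ S' → (S ∩ S').card = 2 → S' ∈ A) → A = tri.filter fun S => v ∈ S)) ∧
    ((∀ S v, 0 ≤ ang S v) ∧ (∀ S v, v ∉ S → ang S v = 0) ∧ (∀ v, ∑ S ∈ tri, ang S v = 2 * Real.pi) ∧
      (∀ S ∈ tri, (∀ v ∈ S, ∀ w ∈ S, v ≠ w → dist (t v) (t w) ≤ 1 + 1 / 50) →
        ∀ v ∈ S, ang S v ≤ Real.arccos (1 / 4)) ∧
      (∀ S ∈ tri, (∀ v ∈ S, ∀ w ∈ S, v ≠ w → dist (t v) (t w) ≤ 1 + 1 / 50) →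
        ∀ v ∈ S, Real.arccos (81 / 200) ≤ ang S v) ∧
      (∀ v a x, ({v, a, x} : Finset (Fin 12)) ∈ tri → dist (t v) (t a) ≤ 1 + 1 / 50 →
        dist (t a) (t x) ≤ 1 + 1 / 50 → 63 / 50 ≤ dist (t v) (t x) → ang {v, a, x} v ≤ Real.arccos (807 / 2000)) ∧
      (∀ v d a x, ({v, d, a} : Finset (Fin 12)) ∈ tri → dist (t v) (t d) ≤ 1 + 1 / 50 → dist (t v) (t a) ≤ 1 + 1 / 50 →
        63 / 50 ≤ dist (t d) (t a) → dist (t d) (t x) ≤ 1 + 1 / 50 → dist (t x) (t a) ≤ 1 + 1 / 50 →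
        63 / 50 ≤ dist (t v) (t x) → ang {v, d, a} v ≤ 2 * Real.arccos (807 / 2000)) ∧
      (∀ v d a, ({v, d, a} : Finset (Fin 12)) ∈ tri → dist (t v) (t d) ≤ 1 + 1 / 50 → dist (t v) (t a) ≤ 1 + 1 / 50 →
        63 / 50 ≤ dist (t d) (t a) → Real.arccos (1 / 25) ≤ ang {v, d, a} v) ∧
      (∀ v a x z, ({v, a, x} : Finset (Fin 12)) ∈ tri → ({v, x, z} : Finset (Fin 12)) ∈ tri →
        dist (t v) (t a) ≤ 1 + 1 / 50 → dist (t v) (t z) ≤ 1 + 1 / 50 → 63 / 50 ≤ dist (t a) (t z) →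
        Real.arccos (1 / 25) ≤ ang {v, a, x} v + ang {v, x, z} v)) := by
  intro u X tri ang
  -- (`hinj` is part of the registered signature but is implied by the gap hypothesis `hd`;
  -- injectivity of the labelling `u` is taken from the gap, `ffrC5_normalize_injective`)
  have _ := hinj
  -- basic facts about the normalised shell
  have hu : ∀ k, u k = ‖t k‖⁻¹ • t k := fun k => rfl
  have hr : ∀ k, 0 < ‖t k‖ := fun k => by linarith [(hn k).1]
  have hu1 : ∀ k, ‖u k‖ = 1 := fun k => ffrC5_norm_normalize (hn k)
  have huinj : Function.Injective u := ffrC5_normalize_injective t hn hd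
  have hhi : ∀ k l, k ≠ l → ⟪u k, u l⟫ ≤ 2801 / 5202 := fun k l hkl =>
    ffrC5_inner_normalize_le (hn k) (hn l) (hd k l hkl).1
  have hlo : ∀ k l, dist (t k) (t l) ≤ 1 + 1 / 50 → 2201 / 4802 ≤ ⟪u k, u l⟫ := fun k l hkl =>
    ffrC5_le_inner_normalize (hn k) (hn l) hkl
  have hX : X = Finset.univ.image u := rfl
  have htri : ∀ S, S ∈ tri ↔ S.image u ∈ fanTriSets X := fun S =>
    Finset.mem_filter.trans (and_iff_right (Finset.mem_powerset.2 (Finset.subset_univ S)))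
  have hX1 : ∀ y ∈ X, ‖y‖ = 1 := ffrC5D_norm_eq_one_of_mem hu1 hX
  have h0 : (0 : EuclideanSpace ℝ (Fin 3)) ∈
      interior (convexHull ℝ (X : Set (EuclideanSpace ℝ (Fin 3)))) := by
    rw [hX, Finset.coe_image, Finset.coe_univ, Set.image_univ]
    exact stub_ffrC5Interior t hn hd h4
  have hmem : ∀ {S : Finset (Fin 12)}, S ∈ tri → S.image u ∈ fanTriSets X := fun hS =>
    (htri _).1 hS
  have hcard : ∀ {S : Finset (Fin 12)}, S ∈ tri → S.card = 3 := fun hS =>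
    ffrC5D_card_eq_three_of_mem_tri huinj hX1 htri _ hS
  refine ⟨⟨fun S hS => hcard hS, ffrC5D_card_tri huinj hX1 hX htri h0,
    ffrC5D_card_filter_side huinj hX1 hX htri h0,
    fun v w hvw hb => ffrC5D_card_filter_bond huinj hX1 hX htri h0 hhi hvw (hlo v w hb),
    fun a b c hab hbc hac kab kbc kac => ffrC5D_triple_mem_tri huinj hX1 hX htri hhi hab hbc hac
      (hlo a b kab) (hlo b c kbc) (hlo a c kac),
    ffrC5D_link_tri huinj hX1 hX htri h0⟩, ?_⟩
  refine ⟨fun S v => triAngleAt_nonneg _ _ _,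
    fun S v hv => triAngleAt_eq_zero_of_not_mem (mt huinj.mem_finset_image.1 hv),
    fun v => ffrC5D_sum_triAngleAt_labels hX1 huinj h0 v, ?_, ?_, ?_, ?_, ?_, ?_⟩
  · -- T-corner, upper bound: a bonded triangle (`stub_tCornerMax`)
    intro S hS hb v hv
    have hT := hmem hS
    obtain ⟨a, b, hva, hvb, hab, rfl⟩ := ffrC5D_exists_eq_triple (hcard hS) hv
    have ha : a ∈ ({v, a, b} : Finset (Fin 12)) := by simp
    have hb' : b ∈ ({v, a, b} : Finset (Fin 12)) := by simp
    refine (ffrC5D_triAngleAt_labels_eq hu hr hX1 huinj hT hva hvb).trans_le ?_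
    exact stub_tCornerMax (t v) (t a) (t b) (hn v) (hn a) (hn b)
      ⟨(hd v a hva).1, hb v hv a ha hva⟩ ⟨(hd v b hvb).1, hb v hv b hb' hvb⟩
      ⟨(hd a b hab).1, hb a ha b hb' hab⟩
  · -- T-corner, lower bound: a bonded triangle (`stub_tCornerMin`)
    intro S hS hb v hv
    have hT := hmem hS
    obtain ⟨a, b, hva, hvb, hab, rfl⟩ := ffrC5D_exists_eq_triple (hcard hS) hv
    have ha : a ∈ ({v, a, b} : Finset (Fin 12)) := by simp
    have hb' : b ∈ ({v, a, b} : Finset (Fin 12)) := by simp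
    refine LE.le.trans_eq ?_ (ffrC5D_triAngleAt_labels_eq hu hr hX1 huinj hT hva hvb).symm
    exact stub_tCornerMin (t v) (t a) (t b) (hn v) (hn a) (hn b)
      ⟨(hd v a hva).1, hb v hv a ha hva⟩ ⟨(hd v b hvb).1, hb v hv b hb' hvb⟩
      ⟨(hd a b hab).1, hb a ha b hb' hab⟩
  · -- H-corner: `{v, a, x}` with bonds `va`, `ax` and `vx` far (`stub_hCornerMax`)
    intro v a x hS hva hax hvx
    have hT := hmem hS
    obtain ⟨hva', hvx'⟩ := ffrC5D_ne_of_card_triple (hcard hS)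
    have hax' : a ≠ x := fun h => by rw [h] at hva; linarith
    refine (ffrC5D_triAngleAt_labels_eq hu hr hX1 huinj hT hva' hvx').trans_le ?_
    exact stub_hCornerMax (t v) (t a) (t x) (hn v) (hn a) (hn x) ⟨(hd v a hva').1, hva⟩
      ⟨(hd a x hax').1, hax⟩ hvx
  · -- Q-corner, upper bound: `{v, d, a}` with the quad `v d x a` split by its far diagonal `vx`
    intro v d a x hS hvd hva _hda hdx hxa hvx
    have hT := hmem hS
    obtain ⟨hvd', hva'⟩ := ffrC5D_ne_of_card_triple (hcard hS)
    have hdx' : d ≠ x := fun h => by rw [h] at hvd; linarith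
    have hax' : a ≠ x := fun h => by rw [h] at hva; linarith
    refine (ffrC5D_triAngleAt_labels_eq hu hr hX1 huinj hT hvd' hva').trans_le ?_
    calc angle (perpTo (t v) (t d)) (perpTo (t v) (t a))
        ≤ angle (perpTo (t v) (t d)) (perpTo (t v) (t x)) +
            angle (perpTo (t v) (t x)) (perpTo (t v) (t a)) := angle_le_angle_add_angle _ _ _
      _ ≤ Real.arccos (807 / 2000) + Real.arccos (807 / 2000) := by
          refine add_le_add (stub_hCornerMax (t v) (t d) (t x) (hn v) (hn d) (hn x)
            ⟨(hd v d hvd').1, hvd⟩ ⟨(hd d x hdx').1, hdx⟩ hvx) ?_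
          rw [angle_comm]
          exact stub_hCornerMax (t v) (t a) (t x) (hn v) (hn a) (hn x) ⟨(hd v a hva').1, hva⟩
            ⟨(hd a x hax').1, by rw [dist_comm]; exact hxa⟩ hvx
      _ = 2 * Real.arccos (807 / 2000) := (two_mul _).symm
  · -- Q-corner, lower bound: `{v, d, a}` with bonds `vd`, `va`, and `da` far
    -- (`stub_ffrC5QCornerMin`)
    intro v d a hS hvd hva hda
    have hT := hmem hS
    obtain ⟨hvd', hva'⟩ := ffrC5D_ne_of_card_triple (hcard hS)
    refine LE.le.trans_eq ?_ (ffrC5D_triAngleAt_labels_eq hu hr hX1 huinj hT hvd' hva').symm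
    exact stub_ffrC5QCornerMin (t v) (t d) (t a) (hn v) (hn d) (hn a) ⟨(hd v d hvd').1, hvd⟩
      ⟨(hd v a hva').1, hva⟩ hda
  · -- H-pair: `{v, a, x}`, `{v, x, z}` with bonds `va`, `vz` and `az` far: the two angles at `v`
    -- add up to at least the dihedral angle from `a` to `z` (`angle_le_angle_add_angle`)
    intro v a x z hS hS' hva hvz haz
    have hT := hmem hS
    have hT' := hmem hS'
    obtain ⟨hva', hvx'⟩ := ffrC5D_ne_of_card_triple (hcard hS)
    obtain ⟨hvx'', hvz'⟩ := ffrC5D_ne_of_card_triple (hcard hS')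
    have haz' : a ≠ z := fun h => by
      rw [h, dist_self] at haz
      linarith
    have e1 := ffrC5D_triAngleAt_labels_eq hu hr hX1 huinj hT hva' hvx'
    have e2 := ffrC5D_triAngleAt_labels_eq hu hr hX1 huinj hT' hvx'' hvz'
    calc Real.arccos (1 / 25) ≤ angle (perpTo (t v) (t a)) (perpTo (t v) (t z)) :=
          stub_ffrC5QCornerMin (t v) (t a) (t z) (hn v) (hn a) (hn z) ⟨(hd v a hva').1, hva⟩
            ⟨(hd v z hvz').1, hvz⟩ haz
      _ ≤ angle (perpTo (t v) (t a)) (perpTo (t v) (t x)) +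
            angle (perpTo (t v) (t x)) (perpTo (t v) (t z)) := angle_le_angle_add_angle _ _ _
      _ = ang {v, a, x} v + ang {v, x, z} v := by rw [← e1, ← e2]

/-- **`stub_ffrC5Dict`, explicit-argument form** (registered sub-goal `stub_ffrC5DictArgs`): the
abbreviations `u`, `X`, `tri`, `ang` are explicit arguments with their defining equations (a
`let` in a registered signature is cut at its `:=` by the stub registry, so the `let` form above
cannot be matched by the gate; this form can); immediate from `stub_ffrC5Dict`. [folklore] -/
theorem stub_ffrC5DictArgs (t : Fin 12 → EuclideanSpace ℝ (Fin 3)) (hinj : Function.Injective t)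
    (hn : ∀ k, 1 - 1 / 50 ≤ ‖t k‖ ∧ ‖t k‖ ≤ 1 + 1 / 50)
    (hd : ∀ k l, k ≠ l → 1 - 1 / 50 ≤ dist (t k) (t l) ∧ (dist (t k) (t l) ≤ 1 + 1 / 50 ∨ 63 / 50 ≤ dist (t k) (t l)))
    (h4 : ∀ k, 4 ≤ (Finset.univ.filter fun l => l ≠ k ∧ dist (t k) (t l) ≤ 1 + 1 / 50).card)
    (u : Fin 12 → EuclideanSpace ℝ (Fin 3)) (hu : u = fun k => ‖t k‖⁻¹ • t k)
    (X : Finset (EuclideanSpace ℝ (Fin 3))) (hX : X = Finset.univ.image u)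
    (tri : Finset (Finset (Fin 12)))
    (htri : tri = Finset.univ.powerset.filter fun S => S.image u ∈ fanTriSets X)
    (ang : Finset (Fin 12) → Fin 12 → ℝ) (hang : ang = fun S k => triAngleAt X (S.image u) (u k)) :
    ((∀ S ∈ tri, S.card = 3) ∧ tri.card = 20 ∧
      (∀ S ∈ tri, ∀ s ⊆ S, s.card = 2 → (tri.filter fun S' => s ⊆ S').card = 2) ∧
      (∀ v w, v ≠ w → dist (t v) (t w) ≤ 1 + 1 / 50 →
        (tri.filter fun S' => ({v, w} : Finset (Fin 12)) ⊆ S').card = 2) ∧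
      (∀ a b c, a ≠ b → b ≠ c → a ≠ c → dist (t a) (t b) ≤ 1 + 1 / 50 → dist (t b) (t c) ≤ 1 + 1 / 50 →
        dist (t a) (t c) ≤ 1 + 1 / 50 → ({a, b, c} : Finset (Fin 12)) ∈ tri) ∧
      (∀ v, ∀ A ⊆ tri.filter (fun S => v ∈ S), A.Nonempty →
        (∀ S ∈ A, ∀ S' ∈ tri, v ∈ S' → (S ∩ S').card = 2 → S' ∈ A) → A = tri.filter fun S => v ∈ S)) ∧
    ((∀ S v, 0 ≤ ang S v) ∧ (∀ S v, v ∉ S → ang S v = 0) ∧ (∀ v, ∑ S ∈ tri, ang S v = 2 * Real.pi) ∧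
      (∀ S ∈ tri, (∀ v ∈ S, ∀ w ∈ S, v ≠ w → dist (t v) (t w) ≤ 1 + 1 / 50) →
        ∀ v ∈ S, ang S v ≤ Real.arccos (1 / 4)) ∧
      (∀ S ∈ tri, (∀ v ∈ S, ∀ w ∈ S, v ≠ w → dist (t v) (t w) ≤ 1 + 1 / 50) →
        ∀ v ∈ S, Real.arccos (81 / 200) ≤ ang S v) ∧
      (∀ v a x, ({v, a, x} : Finset (Fin 12)) ∈ tri → dist (t v) (t a) ≤ 1 + 1 / 50 →
        dist (t a) (t x) ≤ 1 + 1 / 50 → 63 / 50 ≤ dist (t v) (t x) → ang {v, a, x} v ≤ Real.arccos (807 / 2000)) ∧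
      (∀ v d a x, ({v, d, a} : Finset (Fin 12)) ∈ tri → dist (t v) (t d) ≤ 1 + 1 / 50 → dist (t v) (t a) ≤ 1 + 1 / 50 →
        63 / 50 ≤ dist (t d) (t a) → dist (t d) (t x) ≤ 1 + 1 / 50 → dist (t x) (t a) ≤ 1 + 1 / 50 →
        63 / 50 ≤ dist (t v) (t x) → ang {v, d, a} v ≤ 2 * Real.arccos (807 / 2000)) ∧
      (∀ v d a, ({v, d, a} : Finset (Fin 12)) ∈ tri → dist (t v) (t d) ≤ 1 + 1 / 50 → dist (t v) (t a) ≤ 1 + 1 / 50 →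
        63 / 50 ≤ dist (t d) (t a) → Real.arccos (1 / 25) ≤ ang {v, d, a} v) ∧
      (∀ v a x z, ({v, a, x} : Finset (Fin 12)) ∈ tri → ({v, x, z} : Finset (Fin 12)) ∈ tri →
        dist (t v) (t a) ≤ 1 + 1 / 50 → dist (t v) (t z) ≤ 1 + 1 / 50 → 63 / 50 ≤ dist (t a) (t z) →
        Real.arccos (1 / 25) ≤ ang {v, a, x} v + ang {v, x, z} v)) := by
  subst hang htri hX hu
  exact stub_ffrC5Dict t hinj hn hd h4

end Summit.AtomisticToContinuum.Crystallization.Theorems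

end
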